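import Summits.MatrixMultiplication.MatrixMultiplication.Theorems.SubgroupIdentityDesigns.Negative.TripleCells

/-!
# Upper rectangles and the diagonal-subgroup law (negative lemmas for the crux
# `SubgroupIdentityDesigns`, stmt-MatrixMultiplication-14079) — VALUE = THEOREM (all p, explicit
# certificate), NOT summit progress; the crux stays open.

User-facing forms of the triple rectangle law (`TripleCells.no_idTest_of_cells_in_triple`).
Since `H₁H₂H₃` is left-`U⁺`-invariant once `U⁺ ≤ H₁`, a cell `B(α, β)` lies in it as soon as ONE
upper-triangular point with diagonal `(α, β)` does (`cell_of_upper_triple`).  Hence: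

* `no_idTest_of_upper_rectangle` — three upper-triangular points of `H₁H₂H₃` with diagonals
  `(1, μ)`, `(a, 1)`, `(a, μ)` (`a, μ ∉ {0,1}`) exclude every level-1 identity design.  By the
  census of ORACLE §G14-11 (jobs j111725, j111747) this single criterion decides EVERY
  two-`p`-member subgroup-TPP triple of `GL₂(p)` above the floor at `p = 7` (5 288 triples) and
  `p = 11` (42 340 triples) — data, not an all-`p` theorem.
* `no_idTest_of_diag_subgroup` — the pigeonhole form: if the diagonals of upper-triangular
  points of `H₁H₂H₃` contain a subgroup `G ≤ 𝔽_p^× × 𝔽_p^×` of order `> p − 1`, both coordinate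
  projections of `G` fail to be injective, so `G` meets both axes non-trivially and the rectangle
  `{1, a} × {1, μ}` lies in `G`.  Typical instance: `G = T̃₁ · T̃₂ · Λ` with `Λ` the diagonal
  image of `H₃ ∩ B⁺` (so `|T₁| · |T₂| · |H₃ ∩ B⁺| > p − 1` kills, e.g. the frame survivor).
No TPP hypothesis is used.
-/

set_option linter.dupNamespace false

noncomputable section

open scoped BigOperators Classical
open Summit.MatrixMultiplication.MatrixMultiplication.Theorems.LieRankDesigns.Negative
  (GLm Mat fourierFn)
open Summit.MatrixMultiplication.MatrixMultiplication.Theorems.LevelOneGL2Designs.Negative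
  (levelSubmodule mem_levelSubmodule_iff fourierFn_mem_levelSubmodule levelSubmodule_bi_inv)

namespace Summit.MatrixMultiplication.MatrixMultiplication.Theorems.SubgroupIdentityDesigns.Negative

section DiagonalRectangles

variable {p : ℕ} [hp : Fact p.Prime]

/-- Cells from upper-triangular points: if `U⁺ ≤ H₁` and some triple product `a b c` is upper
triangular with diagonal `(α, β)`, the whole cell `B(α, β)` consists of triple products. -/
theorem cell_of_upper_triple {H₁ H₂ H₃ : Subgroup (GLm p 2)}
    (hU : ∀ u : GLm p 2, (u : Mat p 2) 1 0 = 0 → (u : Mat p 2) 0 0 = 1 → (u : Mat p 2) 1 1 = 1 →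
      u ∈ H₁)
    {α β : ZMod p} (hβ : β ≠ 0)
    (h : ∃ y : ZMod p, ∃ a ∈ H₁, ∃ b ∈ H₂, ∃ c ∈ H₃,
      ((a * b * c : GLm p 2) : Mat p 2) = !![α, y; 0, β])
    (x : ZMod p) :
    ∃ a ∈ H₁, ∃ b ∈ H₂, ∃ c ∈ H₃, ((a * b * c : GLm p 2) : Mat p 2) = !![α, x; 0, β] := by
  obtain ⟨y, a, ha, b, hb, c, hc, habc⟩ := h
  obtain ⟨u, hu⟩ : ∃ u : GLm p 2, (u : Mat p 2) = !![1, (x - y) / β; 0, 1] :=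
    ⟨Matrix.GeneralLinearGroup.mkOfDetNeZero _ (by rw [Matrix.det_fin_two_of]; simp), rfl⟩
  refine ⟨u * a, H₁.mul_mem (hU u (by simp [hu]) (by simp [hu]) (by simp [hu])) ha, b, hb, c, hc,
    ?_⟩
  have hm : ((u * a * b * c : GLm p 2) : Mat p 2) =
      (u : Mat p 2) * ((a * b * c : GLm p 2) : Mat p 2) := by
    simp only [Units.val_mul, mul_assoc]
  rw [hm, hu, habc]
  ext i j
  fin_cases i <;> fin_cases j <;> simp [Matrix.mul_apply, Fin.sum_univ_two]
  field_simp
  ring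

/-- **Upper rectangle law.**  `U⁺ ≤ H₁` and three upper-triangular points of `H₁H₂H₃` with
diagonals `(1, μ)`, `(a, 1)`, `(a, μ)` (`a, μ ∉ {0, 1}`) exclude every level-1 identity design
(no TPP hypothesis). -/
theorem no_idTest_of_upper_rectangle {H₁ H₂ H₃ : Subgroup (GLm p 2)}
    (hU : ∀ u : GLm p 2, (u : Mat p 2) 1 0 = 0 → (u : Mat p 2) 0 0 = 1 → (u : Mat p 2) 1 1 = 1 →
      u ∈ H₁)
    {a μ : ZMod p} (ha0 : a ≠ 0) (ha1 : a ≠ 1) (hμ0 : μ ≠ 0) (hμ1 : μ ≠ 1)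
    (h1μ : ∃ y : ZMod p, ∃ a' ∈ H₁, ∃ b ∈ H₂, ∃ c ∈ H₃,
      ((a' * b * c : GLm p 2) : Mat p 2) = !![1, y; 0, μ])
    (ha1' : ∃ y : ZMod p, ∃ a' ∈ H₁, ∃ b ∈ H₂, ∃ c ∈ H₃,
      ((a' * b * c : GLm p 2) : Mat p 2) = !![a, y; 0, 1])
    (haμ : ∃ y : ZMod p, ∃ a' ∈ H₁, ∃ b ∈ H₂, ∃ c ∈ H₃,
      ((a' * b * c : GLm p 2) : Mat p 2) = !![a, y; 0, μ]) :
    ¬ ∃ f ∈ levelSubmodule p 2 1, f 1 = 1 ∧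
        ∀ a' ∈ H₁, ∀ b ∈ H₂, ∀ c ∈ H₃, a' * b * c ≠ 1 → f (a' * b * c) = 0 := by
  have h11 : ∃ y : ZMod p, ∃ a' ∈ H₁, ∃ b ∈ H₂, ∃ c ∈ H₃,
      ((a' * b * c : GLm p 2) : Mat p 2) = !![1, y; 0, 1] :=
    ⟨0, 1, H₁.one_mem, 1, H₂.one_mem, 1, H₃.one_mem, by
      rw [mul_one, mul_one]; exact coe_one_eq_ucell⟩
  refine no_idTest_of_cells_in_triple ha0 ha1 hμ0 hμ1 fun α β hα hβ x => ?_
  rcases hα with hα | hα <;> rcases hβ with hβ | hβ <;> rw [hα, hβ]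
  · exact cell_of_upper_triple hU one_ne_zero h11 x
  · exact cell_of_upper_triple hU hμ0 h1μ x
  · exact cell_of_upper_triple hU one_ne_zero ha1' x
  · exact cell_of_upper_triple hU hμ0 haμ x

/-- **Diagonal-subgroup law (pigeonhole).**  If `U⁺ ≤ H₁` and the diagonals of upper-triangular
points of `H₁H₂H₃` contain a subgroup `G` of `𝔽_p^× × 𝔽_p^×` with `|G| > p − 1`, there is no
level-1 identity design: neither coordinate projection of `G` is injective, so `G` contains
`(a, 1)` and `(1, μ)` with `a, μ ≠ 1`, hence the rectangle `{1, a} × {1, μ}`. -/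
theorem no_idTest_of_diag_subgroup {H₁ H₂ H₃ : Subgroup (GLm p 2)}
    (hU : ∀ u : GLm p 2, (u : Mat p 2) 1 0 = 0 → (u : Mat p 2) 0 0 = 1 → (u : Mat p 2) 1 1 = 1 →
      u ∈ H₁)
    (G : Subgroup ((ZMod p)ˣ × (ZMod p)ˣ))
    (hG : ∀ g ∈ G, ∃ y : ZMod p, ∃ a ∈ H₁, ∃ b ∈ H₂, ∃ c ∈ H₃,
      ((a * b * c : GLm p 2) : Mat p 2) = !![((g.1 : (ZMod p)ˣ) : ZMod p), y; 0, (g.2 : ZMod p)])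
    (hcard : p - 1 < Nat.card G) :
    ¬ ∃ f ∈ levelSubmodule p 2 1, f 1 = 1 ∧
        ∀ a' ∈ H₁, ∀ b ∈ H₂, ∀ c ∈ H₃, a' * b * c ≠ 1 → f (a' * b * c) = 0 := by
  have hlt : Fintype.card (ZMod p)ˣ < Fintype.card G := by
    rw [ZMod.card_units p, ← Nat.card_eq_fintype_card]; exact hcard
  -- an element `h ∈ G` on the first axis: `h.2 = 1`, `h.1 ≠ 1`
  obtain ⟨x, y, hxy, hf⟩ :=
    Fintype.exists_ne_map_eq_of_card_lt (fun g : G => ((g : (ZMod p)ˣ × (ZMod p)ˣ)).2) hlt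
  obtain ⟨x', y', hxy', hf'⟩ :=
    Fintype.exists_ne_map_eq_of_card_lt (fun g : G => ((g : (ZMod p)ˣ × (ZMod p)ˣ)).1) hlt
  set h : (ZMod p)ˣ × (ZMod p)ˣ := (x : (ZMod p)ˣ × (ZMod p)ˣ) * (y : (ZMod p)ˣ × (ZMod p)ˣ)⁻¹
    with hh
  set h' : (ZMod p)ˣ × (ZMod p)ˣ := (x' : (ZMod p)ˣ × (ZMod p)ˣ) * (y' : (ZMod p)ˣ × (ZMod p)ˣ)⁻¹
    with hh'
  have hhG : h ∈ G := G.mul_mem x.2 (G.inv_mem y.2)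
  have hh'G : h' ∈ G := G.mul_mem x'.2 (G.inv_mem y'.2)
  have hh2 : h.2 = 1 := by
    simp only [hh, Prod.snd_mul, Prod.snd_inv, mul_inv_eq_one]; exact hf
  have hh'1 : h'.1 = 1 := by
    simp only [hh', Prod.fst_mul, Prod.fst_inv, mul_inv_eq_one]; exact hf'
  have hh1 : h.1 ≠ 1 := by
    intro h1
    simp only [hh, Prod.fst_mul, Prod.fst_inv, mul_inv_eq_one] at h1
    exact hxy (Subtype.ext (Prod.ext h1 hf))
  have hh'2 : h'.2 ≠ 1 := by
    intro h2
    simp only [hh', Prod.snd_mul, Prod.snd_inv, mul_inv_eq_one] at h2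
    exact hxy' (Subtype.ext (Prod.ext hf' h2))
  have ha0 : ((h.1 : (ZMod p)ˣ) : ZMod p) ≠ 0 := h.1.ne_zero
  have ha1 : ((h.1 : (ZMod p)ˣ) : ZMod p) ≠ 1 := fun e => hh1 (Units.ext (by simpa using e))
  have hμ0 : ((h'.2 : (ZMod p)ˣ) : ZMod p) ≠ 0 := h'.2.ne_zero
  have hμ1 : ((h'.2 : (ZMod p)ˣ) : ZMod p) ≠ 1 := fun e => hh'2 (Units.ext (by simpa using e))
  have hp1 := hG h' hh'G
  have hp2 := hG h hhG
  have hp3 := hG (h * h') (G.mul_mem hhG hh'G)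
  rw [hh'1] at hp1
  rw [hh2] at hp2
  rw [Prod.fst_mul, Prod.snd_mul, hh'1, hh2, mul_one, one_mul] at hp3
  simp only [Units.val_one] at hp1 hp2
  exact no_idTest_of_upper_rectangle hU ha0 ha1 hμ0 hμ1 hp1 hp2 hp3

/-- The diagonal-subgroup law in the vocabulary of the crux `SubgroupIdentityDesigns`. -/
theorem no_levelOne_design_of_diag_subgroup {H₁ H₂ H₃ : Subgroup (GLm p 2)}
    (hU : ∀ u : GLm p 2, (u : Mat p 2) 1 0 = 0 → (u : Mat p 2) 0 0 = 1 → (u : Mat p 2) 1 1 = 1 →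
      u ∈ H₁)
    (G : Subgroup ((ZMod p)ˣ × (ZMod p)ˣ))
    (hG : ∀ g ∈ G, ∃ y : ZMod p, ∃ a ∈ H₁, ∃ b ∈ H₂, ∃ c ∈ H₃,
      ((a * b * c : GLm p 2) : Mat p 2) = !![((g.1 : (ZMod p)ˣ) : ZMod p), y; 0, (g.2 : ZMod p)])
    (hcard : p - 1 < Nat.card G) :
    ¬ ∃ c : Mat p 2 → ℂ, (∀ M, 1 < M.rank → c M = 0) ∧
        (∑ M, c M * ZMod.stdAddChar (Matrix.trace (M * ((1 : GLm p 2) : Mat p 2)))) = 1 ∧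
        ∀ a' ∈ H₁, ∀ b ∈ H₂, ∀ g ∈ H₃, a' * b * g ≠ 1 →
          (∑ M, c M *
            ZMod.stdAddChar (Matrix.trace (M * ((a' * b * g : GLm p 2) : Mat p 2)))) = 0 := by
  rintro ⟨c, hc, hc1, hc0⟩
  refine no_idTest_of_diag_subgroup hU G hG hcard
    ⟨fourierFn c, fourierFn_mem_levelSubmodule hc, hc1, fun a' ha b hb g hg hne => ?_⟩
  exact hc0 a' ha b hb g hg hne

end DiagonalRectangles

end Summit.MatrixMultiplication.MatrixMultiplication.Theorems.SubgroupIdentityDesigns.Negative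

end
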